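import Literature.MathematicalPhysics.QuantumFieldTheory.Balaban1983to89.B14ChangeOfVariables
import Mathlib.Analysis.Calculus.BumpFunction.FiniteDimension

/-!
# `Balaban1983to89.B14Eq122CutoffExists` — [Balaban1988Convergent] p. 252: **the cut-off `g` of the change of
# variables (1.22) EXISTS with all four printed properties** on every finite-dimensional carrier — a non-vacuity
# witness for `B14.ChangeOfVariables.IsCutoff`

statement-level skeleton of published theorems with citation tags; proofs where landed; nothing here is a
claim about the Yang–Mills mass gap

CITATION HEADER (lean-in-tree rule).  Source: T. Bałaban, *Convergent renormalization expansions for lattice gauge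
theories*, Commun. Math. Phys. **119**, 243–285 (1988), doi:10.1007/bf01217741 [Balaban1988Convergent] (cell paper
B14 = "[III]"; held `paper:balaban1988-cmp119-convergent-renormalization`, journal page = PDF page + 242; the sentence
below was read on the x2 render `…-p010-x2.png` (p. 252) of `run/shared/lean/pub/pub-balaban/b2b-balaban-ref1/pages/
1988-cmp119-convergent-renormalization/` and on the text layer `p0010.txt`).  Mega-formalization `lit-balaban`, unit
`lit-balaban-r11` (CMP 119), SKELETON row B14.Eq1.22 (the cut-off `g` of p. 252 is part of that row; the predicate
`IsCutoff` is r11 gen 1, `B14ChangeOfVariables`, p239312).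

THE PRINTED SENTENCE (p. 252 [PDF 10], verbatim): *"Here g is a C^∞-function defined on the Lie algebra 𝐠,
0 ≤ g(A′) ≤ 1, g(A′) = 0 on {A′ ∈ 𝐠 : |A′| ≤ 4/3 g₀⁻¹δ₀}, g(A′) = 1 on {A′ ∈ 𝐠 : |exp ig₀A′ − 1| ≥ 5/3 δ₀}."*
Its typed reading is `B14.ChangeOfVariables.IsCutoff g₀ δ₀ g` (the four clauses verbatim, `|·|` = the norm of the
carrier, `C^∞` = `ContDiff ℝ ∞`).  Print presupposes that such a `g` exists; the tree had no witness.  Existence is not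
free: it needs (i) the two printed regions to be DISJOINT — a point of the closed ball `|A′| ≤ 4/3 g₀⁻¹δ₀` has
`|exp ig₀A′ − 1| ≤ e^{4δ₀/3} − 1`, which is `< 5/3 δ₀` exactly when `δ₀` is small (certainly for `δ₀ < 3/16`, by
`eˣ ≤ 1 + x + x²` on `|x| ≤ 1`; print: *"δ₀"* is the small constant `(A₁/A₀)ε₀` of (1.8)) — and (ii) smooth Urysohn
functions between norm balls, which exist on FINITE-DIMENSIONAL carriers (print's 𝐠) — Mathlib's `ContDiffBump`
through the instance `HasContDiffBump` of finite-dimensional real normed spaces.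

WHAT IS PROVED (every normed `ℂ`-algebra `𝔸` that is finite-dimensional over `ℝ`, complete where the exponential bound is
used — print's 𝐠 ⊂ u(N) sits in such an `𝔸`; `0 < g₀`, `0 < δ₀ < 3/16`):
* `norm_exp_smul_sub_one_lt_of_norm_lt` — the consistency of the printed prescription: `|A′| < g₀⁻¹ log(1 + 5/3 δ₀)`
  (in particular `|A′| ≤ 4/3 g₀⁻¹δ₀`, `radius_lt`) forces `|exp ig₀A′ − 1| < 5/3 δ₀`, so the `g = 0` region and the
  `g = 1` region are a positive distance apart;
* `isCutoff_one_sub_bump` — the witness recipe: `g := 1 − φ` for ANY smooth bump `φ` (Mathlib `ContDiffBump`) equal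
  to `1` on a closed ball of radius `≥ 4/3 g₀⁻¹δ₀` and supported in the open ball of radius `≤ g₀⁻¹ log(1 + 5/3 δ₀)`
  has the four printed properties (no smallness of `δ₀` needed for this step);
* `exists_isCutoff : ∃ g, IsCutoff g₀ δ₀ g` for `0 < δ₀ < 3/16` (the two radii are then compatible, `radius_lt`).
Theorems only (no new definition, no named fact); nothing printed is asserted beyond the sentence above; no `sorry`,
no axiom beyond the standard three.
-/

namespace Literature.MathematicalPhysics.QuantumFieldTheory.Balaban1983to89.B14.Eq122CutoffExists

open NormedSpace Metric
open Literature.MathematicalPhysics.QuantumFieldTheory.Balaban1983to89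
open Literature.MathematicalPhysics.QuantumFieldTheory.Balaban1983to89.B14.ChangeOfVariables
open scoped ContDiff

section Consistency

variable {𝔸 : Type*} [NormedRing 𝔸] [NormedAlgebra ℂ 𝔸] [CompleteSpace 𝔸]

/-- The elementary inequality behind the disjointness of the two printed regions: for `0 < δ₀ < 3/16`,
`e^{4δ₀/3} < 1 + 5δ₀/3` (from `|eˣ − 1 − x| ≤ x²`, `|x| ≤ 1`). [cite: Balaban1988Convergent, p.252] -/
theorem exp_four_thirds_lt {δ₀ : ℝ} (hδ0 : 0 < δ₀) (hδ : δ₀ < 3 / 16) :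
    Real.exp (4 / 3 * δ₀) < 1 + 5 / 3 * δ₀ := by
  have hx : |4 / 3 * δ₀| ≤ 1 := by
    rw [abs_of_nonneg (by positivity)]
    linarith
  have h := Real.abs_exp_sub_one_sub_id_le hx
  have h' : Real.exp (4 / 3 * δ₀) - 1 - 4 / 3 * δ₀ ≤ (4 / 3 * δ₀) ^ 2 := le_trans (le_abs_self _) h
  nlinarith

/-- Hence the inner radius `4/3 g₀⁻¹δ₀` of the `g = 0` ball is STRICTLY smaller than `g₀⁻¹ log(1 + 5/3 δ₀)`, the
radius inside which `|exp ig₀A′ − 1| < 5/3 δ₀`. [cite: Balaban1988Convergent, p.252] -/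
theorem radius_lt {g₀ δ₀ : ℝ} (hg0 : 0 < g₀) (hδ0 : 0 < δ₀) (hδ : δ₀ < 3 / 16) :
    4 / 3 * g₀⁻¹ * δ₀ < g₀⁻¹ * Real.log (1 + 5 / 3 * δ₀) := by
  have hpos : 0 < 1 + 5 / 3 * δ₀ := by positivity
  have hlog : 4 / 3 * δ₀ < Real.log (1 + 5 / 3 * δ₀) := by
    rw [Real.lt_log_iff_exp_lt hpos]
    exact exp_four_thirds_lt hδ0 hδ
  have h := mul_lt_mul_of_pos_left hlog (inv_pos.mpr hg0)
  calc 4 / 3 * g₀⁻¹ * δ₀ = g₀⁻¹ * (4 / 3 * δ₀) := by ring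
    _ < g₀⁻¹ * Real.log (1 + 5 / 3 * δ₀) := h

omit [CompleteSpace 𝔸] in
/-- `‖(i g₀) • A‖ = g₀‖A‖` for `g₀ ≥ 0`. [cite: Balaban1988Convergent, (1.22) p.251] -/
theorem norm_I_mul_ofReal_smul {g₀ : ℝ} (hg0 : 0 ≤ g₀) (A : 𝔸) :
    ‖((Complex.I : ℂ) * (g₀ : ℂ)) • A‖ = g₀ * ‖A‖ := by
  rw [norm_smul, norm_mul, Complex.norm_I, one_mul, Complex.norm_real, Real.norm_of_nonneg hg0]

/-- **Consistency of the p. 252 prescription.**  Inside the ball `|A′| < g₀⁻¹ log(1 + 5/3 δ₀)` one has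
`|exp ig₀A′ − 1| < 5/3 δ₀` (Banach-algebra bound `|eˣ − 1| ≤ e^{|x|} − 1`); by `radius_lt` this ball contains the
closed ball `|A′| ≤ 4/3 g₀⁻¹δ₀` on which print sets `g = 0`, so that ball misses the region `|exp ig₀A′ − 1| ≥ 5/3 δ₀`
on which print sets `g = 1`. [cite: Balaban1988Convergent, p.252] -/
theorem norm_exp_smul_sub_one_lt_of_norm_lt {g₀ δ₀ : ℝ} (hg0 : 0 < g₀) (hδ0 : 0 < δ₀) {A : 𝔸}
    (hA : ‖A‖ < g₀⁻¹ * Real.log (1 + 5 / 3 * δ₀)) :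
    ‖exp (((Complex.I : ℂ) * (g₀ : ℂ)) • A) - 1‖ < 5 / 3 * δ₀ := by
  have hpos : 0 < 1 + 5 / 3 * δ₀ := by positivity
  have h1 := Literature.Analysis.Calculus.norm_exp_sub_one_le (((Complex.I : ℂ) * (g₀ : ℂ)) • A)
  rw [norm_I_mul_ofReal_smul hg0.le] at h1
  have h2 : g₀ * ‖A‖ < Real.log (1 + 5 / 3 * δ₀) := by
    have h := mul_lt_mul_of_pos_left hA hg0
    rwa [← mul_assoc, mul_inv_cancel₀ hg0.ne', one_mul] at h
  have h3 : Real.exp (g₀ * ‖A‖) < 1 + 5 / 3 * δ₀ := by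
    calc Real.exp (g₀ * ‖A‖) < Real.exp (Real.log (1 + 5 / 3 * δ₀)) := Real.exp_lt_exp.mpr h2
      _ = 1 + 5 / 3 * δ₀ := Real.exp_log hpos
  linarith

/-- In particular on print's `g = 0` ball: `|A′| ≤ 4/3 g₀⁻¹δ₀ ⇒ |exp ig₀A′ − 1| < 5/3 δ₀` (`0 < δ₀ < 3/16`), i.e. the two
printed regions are disjoint. [cite: Balaban1988Convergent, p.252] -/
theorem norm_exp_smul_sub_one_lt_of_norm_le {g₀ δ₀ : ℝ} (hg0 : 0 < g₀) (hδ0 : 0 < δ₀) (hδ : δ₀ < 3 / 16) {A : 𝔸}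
    (hA : ‖A‖ ≤ 4 / 3 * g₀⁻¹ * δ₀) :
    ‖exp (((Complex.I : ℂ) * (g₀ : ℂ)) • A) - 1‖ < 5 / 3 * δ₀ :=
  norm_exp_smul_sub_one_lt_of_norm_lt hg0 hδ0 (lt_of_le_of_lt hA (radius_lt hg0 hδ0 hδ))

end Consistency

section Witness

variable {𝔸 : Type*} [NormedRing 𝔸] [NormedAlgebra ℂ 𝔸] [CompleteSpace 𝔸] [FiniteDimensional ℝ 𝔸]

/-- **Any smooth bump with the right radii gives the printed cut-off.**  Let `φ` be a smooth bump at the origin of the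
finite-dimensional carrier (Mathlib `ContDiffBump`, a genuine `C^∞` function through the instance `HasContDiffBump`)
equal to `1` on a closed ball of radius `≥ 4/3 g₀⁻¹δ₀` and supported in the open ball of radius
`≤ g₀⁻¹ log(1 + 5/3 δ₀)`.  Then `g := 1 − φ` has the four properties of p. 252: `C^∞`; `0 ≤ g ≤ 1`; `g = 0` on
`{|A′| ≤ 4/3 g₀⁻¹δ₀}`; `g = 1` on `{|exp ig₀A′ − 1| ≥ 5/3 δ₀}` (such an `A′` lies outside the support ball by
`norm_exp_smul_sub_one_lt_of_norm_lt`). [cite: Balaban1988Convergent, p.252] -/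
theorem isCutoff_one_sub_bump {g₀ δ₀ : ℝ} (hg0 : 0 < g₀) (hδ0 : 0 < δ₀) (φ : ContDiffBump (0 : 𝔸))
    (hIn : 4 / 3 * g₀⁻¹ * δ₀ ≤ φ.rIn) (hOut : φ.rOut ≤ g₀⁻¹ * Real.log (1 + 5 / 3 * δ₀)) :
    IsCutoff g₀ δ₀ (fun A : 𝔸 => 1 - φ A) := by
  refine ⟨contDiff_const.sub φ.contDiff, fun A => ?_, fun A hA => ?_, fun A hA => ?_⟩
  · have h0 := φ.nonneg' A
    have h1 : φ A ≤ 1 := φ.le_one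
    constructor <;> linarith
  · have hmem : A ∈ closedBall (0 : 𝔸) φ.rIn := by
      rw [mem_closedBall, dist_zero_right]
      exact le_trans hA hIn
    simp only [φ.one_of_mem_closedBall hmem, sub_self]
  · have hle : φ.rOut ≤ dist A 0 := by
      rw [dist_zero_right]
      by_contra h
      push Not at h
      exact absurd hA (not_le.mpr (norm_exp_smul_sub_one_lt_of_norm_lt hg0 hδ0 (lt_of_lt_of_le h hOut)))
    simp only [φ.zero_of_le_dist hle, sub_zero]

/-- **Non-vacuity of `IsCutoff`** (p. 252: *"Here g is a C^∞-function defined on the Lie algebra 𝐠 …"*): for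
`0 < g₀` and `0 < δ₀ < 3/16` a cut-off with the four printed properties exists on every complete normed `ℂ`-algebra
that is finite-dimensional over `ℝ` — the witness is `1 − φ` for the bump with inner radius `4/3 g₀⁻¹δ₀` and outer
radius `g₀⁻¹ log(1 + 5/3 δ₀)`, a legitimate bump by `radius_lt`. [cite: Balaban1988Convergent, p.252] -/
theorem exists_isCutoff {g₀ δ₀ : ℝ} (hg0 : 0 < g₀) (hδ0 : 0 < δ₀) (hδ : δ₀ < 3 / 16) :
    ∃ g : 𝔸 → ℝ, IsCutoff g₀ δ₀ g := by
  let φ : ContDiffBump (0 : 𝔸) :=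
    { rIn := 4 / 3 * g₀⁻¹ * δ₀
      rOut := g₀⁻¹ * Real.log (1 + 5 / 3 * δ₀)
      rIn_pos := by positivity
      rIn_lt_rOut := radius_lt hg0 hδ0 hδ }
  exact ⟨fun A => 1 - φ A, isCutoff_one_sub_bump hg0 hδ0 φ le_rfl le_rfl⟩

end Witness

end Literature.MathematicalPhysics.QuantumFieldTheory.Balaban1983to89.B14.Eq122CutoffExists
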